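import Summits.BirchSwinnertonDyer.BirchSwinnertonDyer.Theorems.ManinLocalTwoThreeKummerCubeRootThreeBounded
import Summits.BirchSwinnertonDyer.Rank1Residual.ManinAdditive.UDCKummerLine
import HarnessLib

/-!
# (BI) `UDCKummerLine.KummerCubeRootThreeBounded` HOLDS, by name
# (route `ManinLocalTwoThree`, crux C3 `ManinPrimeToThreeAtNine` stmt-BirchSwinnertonDyer-22968; cell bsd-f2-manin, prover seat p3 gen 15)

The typer's statement module `…ManinAdditive.UDCKummerLine` (p725103, -an g37's UDC line for the reducible residual of C3, MEMO-an §80.12)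
declares (BI) `KummerCubeRootThreeBounded` as an `@[conjecture]`; this seat's `KummerCubeRootBounded.kummerCubeRoot_threeAdicallyBounded`
(`Theorems/ManinLocalTwoThreeKummerCubeRootThreeBounded.lean`, p725131) has literally its body (binders `W, D, a, ha, 9 ∣ N, X₀ Y₀ hT, z hz,
3 ∣ c`; conclusion `∃ h, h³ = Θ_T ∧ h(0) = −1 ∧ IsThreeAdicallyBounded h` with `IsThreeAdicallyBounded` unfolded), so the row is a THEOREM
BY NAME: `kummerCubeRootThreeBounded_holds`.  (= v21-draft stub 5 `stub_kummerCubeRootThreeBounded` of `Lines/kato_shift_three`.)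
HONEST FRAMING: one node of a conditional reduction; (AN), the printed inputs, C3, Manin's conjecture and BSD are NOT proved.  No sorry.
-/

set_option autoImplicit false
-- lint-debt: the directory name repeats the summit name (sibling precedent `ManinLocalTwoThreeKummerCubeRootThreeBounded.lean`)
set_option linter.dupNamespace false

namespace Summit.BirchSwinnertonDyer.BirchSwinnertonDyer.Theorems.ManinLocalTwoThree

open Summit.BirchSwinnertonDyer.Rank1Residual.ManinAdditive

/-- **(BI) `KummerCubeRootThreeBounded` holds** (`3 ∣ c ⟹` the normalised cube root of the tangent-line Kummer series is `3`-adically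
bounded): this seat's `KummerCubeRootBounded.kummerCubeRoot_threeAdicallyBounded`, by name.  Nothing about C3 or BSD is proved by this.
[cite: Washington1997, Thm. 7.3 and §7.1 (ℤ_p⟦T⟧ is a UFD — Mathlib)] [cite: Honda1970, Thm. 2 (p. 223) (through E-an-55)] -/
theorem kummerCubeRootThreeBounded_holds : UDCKummerLine.KummerCubeRootThreeBounded :=
  fun W _ _ _ _ D a ha h9 X₀ Y₀ hT z hz h3 ↦
    KummerCubeRootBounded.kummerCubeRoot_threeAdicallyBounded W D a ha h9 X₀ Y₀ hT z hz h3

end Summit.BirchSwinnertonDyer.BirchSwinnertonDyer.Theorems.ManinLocalTwoThree
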